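import Literature.AlgebraicGeometry.Resolution.PowerSeriesRegularLocal
import Mathlib.RingTheory.MvPowerSeries.Basic
import Mathlib.Algebra.CharP.Lemmas
import HarnessLib

/-!
# Crux `Steer` (stmt-ResolutionOfSingularities-16345), chain W4.1, hG3 WORK-DIRECT: Lemma F♭ PART 1 — the SUPPORT LEMMA for M free steps
# (power-series side, characteristic 2)

OURS (campaign `res-hironaka`, rung L ★L-G4, slot W4.1; seat res-L0-w41-stub-2 g5, res-L0-w41-plan-1 RULING 136a «stub-2 = Lemma F♭ + ASSEMBLY»;
spec = res-L0-w41-tri-2 `gpd/audit_GPERF_DIRECT.md` §4 CLAIM F♭, mechanism = res-L0-w41-idea-3 `G-PERF-DIRECT.md` §3 (3)–(4); replaces the role of no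
printed item; NOT a statement of the manuscript under review; AI-produced, weaker than expert review).

Setting: `K` a commutative ring of characteristic 2, `K⟦x, y, z⟧ = MvPowerSeries (Fin 3) K` (index `0 = x` the persistent exceptional parameter, `1, 2` the
truncated-arc coordinates `ỹ, z̃`). After `M` consecutive FREE steps of exponent `d` the member satisfies, in the coordinates of stage `M`,
`f₀(x, x^M ỹ_M, x^M z̃_M) = Ψ² + x^(M·d) · F` (telescoped law). Since the substitution is injective on monomials (`(a, b, c) ↦ (a + M(b+c), b, c)`,
preserving parity classes), this is recorded coefficientwise as hypothesis `hrel` below — no substitution API is needed.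

* `G3Perf.coeff_sq_eq_zero_of_odd` — in characteristic 2 a square has only EVEN monomials;
* `G3Perf.free_support` — **support lemma**: every ODD monomial `x^a ỹ^b z̃^c` of `f₀` has `M·d ≤ a + M(b + c)` (so `a ≥ M d` if `b = c = 0`, `a ≥ M(d−1)` if
  `b + c = 1`);
* `G3Perf.mem_span_X_X_sup_span_X_pow` — a series whose coefficients of `x^a` (`a < N`, no `ỹ, z̃`) vanish lies in `(ỹ, z̃) + (x^N)`;
* `G3Perf.pderiv_mem_of_free_support`, `G3Perf.jacobian_le_of_free_support` — **F♭, ideal form**: `𝒥(f₀) = (∂ₓf₀, ∂_ỹ f₀, ∂_z̃ f₀) ≤ (ỹ, z̃) + (x^(M−1))`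
  for `d ≥ 2` — whence `τ(f₀) = ℓ(K⟦x,ỹ,z̃⟧ ⧸ 𝒥) ≥ M − 1` (PART 2) and an isolated member admits at most `τ + 1` consecutive free steps (PART 3 with Lemma S).

[cite: Matsumura1987, §25 (derivations of power series rings)] [folklore]
-/

noncomputable section

set_option linter.dupNamespace false

open MvPowerSeries Literature.AlgebraicGeometry.Resolution

namespace Summit.ResolutionOfSingularities.ResolutionOfSingularities.Theorems.SwitchingDichotomy.G3Perf

variable {K : Type*} [CommRing K]

/-- The exponent of `f₀`'s monomial `x^a ỹ^b z̃^c` read in the coordinates of stage `M` (`ỹ = x^M ỹ_M`, `z̃ = x^M z̃_M`):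
`(a + M(b+c), b, c)`. -/
def freeShift (M : ℕ) (e : Fin 3 →₀ ℕ) : Fin 3 →₀ ℕ :=
  e + Finsupp.single 0 (M * (e 1 + e 2))

/-- `x`-exponent of the shifted monomial. -/
@[simp] theorem freeShift_zero (M : ℕ) (e : Fin 3 →₀ ℕ) : freeShift M e 0 = e 0 + M * (e 1 + e 2) := by
  simp [freeShift]

/-- `ỹ`-exponent is unchanged by the shift. -/
@[simp] theorem freeShift_one (M : ℕ) (e : Fin 3 →₀ ℕ) : freeShift M e 1 = e 1 := by
  simp [freeShift]

/-- `z̃`-exponent is unchanged by the shift. -/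
@[simp] theorem freeShift_two (M : ℕ) (e : Fin 3 →₀ ℕ) : freeShift M e 2 = e 2 := by
  simp [freeShift]

/-- In characteristic 2 a square has only EVEN monomials: if some exponent of `e` is odd then `coeff e (g²) = 0` (the terms of
`coeff e (g·g) = Σ_{p+q=e} g_p g_q` pair off under `(p, q) ↦ (q, p)`, with no fixed point since `e ≠ 2p`). [folklore] -/
theorem coeff_sq_eq_zero_of_odd [CharP K 2] {σ : Type*} [DecidableEq σ] (g : MvPowerSeries σ K) (e : σ →₀ ℕ) {i : σ}
    (hi : Odd (e i)) : coeff e (g ^ 2) = 0 := by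
  classical
  rw [sq, coeff_mul]
  refine Finset.sum_involution (fun p _ => p.swap) ?_ ?_ ?_ ?_
  · intro p hp
    rw [Prod.fst_swap, Prod.snd_swap, mul_comm, CharTwo.add_self_eq_zero]
  · intro p hp _ h
    -- a fixed point would give `e = p.1 + p.1`, contradicting oddness
    exfalso
    rw [Finset.mem_antidiagonal] at hp
    have h1 : p.1 = p.2 := by
      have := congrArg Prod.fst h
      simpa using this.symm
    have : e i = p.1 i + p.1 i := by
      rw [← hp, Finsupp.add_apply, h1]
    rcases hi with ⟨k, hk⟩
    omega
  · intro p hp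
    simpa [Finset.mem_antidiagonal, add_comm] using hp
  · intro p hp
    exact Prod.swap_swap p

/-- An odd exponent survives the free shift: if some coordinate of `e` is odd, so is some coordinate of `freeShift M e`. -/
theorem exists_odd_freeShift (M : ℕ) (e : Fin 3 →₀ ℕ) (h : ∃ i, Odd (e i)) : ∃ j, Odd (freeShift M e j) := by
  by_cases h1 : Odd (e 1)
  · exact ⟨1, by simpa using h1⟩
  by_cases h2 : Odd (e 2)
  · exact ⟨2, by simpa using h2⟩
  obtain ⟨i, hi⟩ := h
  have hi0 : i = 0 := by
    fin_cases i
    · rfl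
    · exact absurd hi h1
    · exact absurd hi h2
  subst hi0
  refine ⟨0, ?_⟩
  rw [freeShift_zero]
  rw [Nat.not_odd_iff_even] at h1 h2
  exact hi.add_even ((h1.add h2).mul_left M)

variable [CharP K 2]

/-- **SUPPORT LEMMA (idea-3 G-PERF-DIRECT §3 (4), finite form).** If `f₀`, read in the stage-`M` coordinates, equals `Ψ² + x^(M·d)·F`
coefficientwise on the images of monomials, then every ODD monomial `x^a ỹ^b z̃^c` of `f₀` satisfies `M·d ≤ a + M·(b + c)`. [folklore] -/
theorem free_support {M d : ℕ} (f₀ Ψ F : MvPowerSeries (Fin 3) K)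
    (hrel : ∀ e : Fin 3 →₀ ℕ, coeff (freeShift M e) (Ψ ^ 2 + X 0 ^ (M * d) * F) = coeff e f₀)
    (e : Fin 3 →₀ ℕ) (hodd : ∃ i, Odd (e i)) (hne : coeff e f₀ ≠ 0) : M * d ≤ e 0 + M * (e 1 + e 2) := by
  classical
  by_contra hlt
  rw [not_le] at hlt
  apply hne
  obtain ⟨j, hj⟩ := exists_odd_freeShift M e hodd
  have h1 : coeff (freeShift M e) (Ψ ^ 2) = 0 := coeff_sq_eq_zero_of_odd Ψ _ hj
  have h2 : coeff (freeShift M e) (X 0 ^ (M * d) * F) = 0 :=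
    (X_pow_dvd_iff.mp (dvd_mul_right _ F)) (freeShift M e) (by simpa [freeShift_zero] using hlt)
  rw [← hrel e, map_add, h1, h2, add_zero]

omit [CharP K 2] in
/-- Membership in `(X₁, X₂) + (X₀^N)` from coefficients: if the coefficients of the pure `x`-monomials `x^a`, `a < N`, vanish, the series lies in
the ideal. (Split the series into its parts with `e 1 ≥ 1`, with `e 1 = 0 < e 2`, and with `e 1 = e 2 = 0`; the first two are multiples of `X₁`,
`X₂` by `X_dvd_iff`, the last of `X₀^N` by `X_pow_dvd_iff`.) [folklore] -/
theorem mem_span_X_X_sup_span_X_pow (h : MvPowerSeries (Fin 3) K) (N : ℕ)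
    (hc : ∀ e : Fin 3 →₀ ℕ, e 1 = 0 → e 2 = 0 → e 0 < N → coeff e h = 0) :
    h ∈ Ideal.span {(X 1 : MvPowerSeries (Fin 3) K), X 2} ⊔ Ideal.span {X 0 ^ N} := by
  classical
  let hA : MvPowerSeries (Fin 3) K := fun e => if e 1 = 0 then 0 else h e
  let hB : MvPowerSeries (Fin 3) K := fun e => if e 1 = 0 ∧ e 2 ≠ 0 then h e else 0
  let hC : MvPowerSeries (Fin 3) K := fun e => if e 1 = 0 ∧ e 2 = 0 then h e else 0
  have hsum : h = hA + hB + hC := by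
    ext e
    change coeff e h = coeff e hA + coeff e hB + coeff e hC
    change h e = (if e 1 = 0 then 0 else h e) + (if e 1 = 0 ∧ e 2 ≠ 0 then h e else 0) + (if e 1 = 0 ∧ e 2 = 0 then h e else 0)
    by_cases h1 : e 1 = 0 <;> by_cases h2 : e 2 = 0 <;> simp [h1, h2]
  have hAd : (X 1 : MvPowerSeries (Fin 3) K) ∣ hA := by
    rw [X_dvd_iff]; intro m hm; change (if m 1 = 0 then 0 else h m) = 0; simp [hm]
  have hBd : (X 2 : MvPowerSeries (Fin 3) K) ∣ hB := by
    rw [X_dvd_iff]; intro m hm; change (if m 1 = 0 ∧ m 2 ≠ 0 then h m else 0) = 0; simp [hm]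
  have hCd : (X 0 : MvPowerSeries (Fin 3) K) ^ N ∣ hC := by
    rw [X_pow_dvd_iff]; intro m hm; change (if m 1 = 0 ∧ m 2 = 0 then h m else 0) = 0
    by_cases h12 : m 1 = 0 ∧ m 2 = 0
    · rw [if_pos h12]; exact hc m h12.1 h12.2 hm
    · rw [if_neg h12]
  rw [hsum]
  refine Ideal.add_mem _ (Ideal.mem_sup_left (Ideal.add_mem _ ?_ ?_)) (Ideal.mem_sup_right ?_)
  · obtain ⟨q, hq⟩ := hAd
    rw [hq]; exact Ideal.mul_mem_right _ _ (Ideal.subset_span (by simp))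
  · obtain ⟨q, hq⟩ := hBd
    rw [hq]; exact Ideal.mul_mem_right _ _ (Ideal.subset_span (by simp))
  · obtain ⟨q, hq⟩ := hCd
    rw [hq]; exact Ideal.mul_mem_right _ _ (Ideal.subset_span (by simp))

/-- **F♭, ideal form — one partial at a time.** Under the support conclusion (every odd monomial `x^a ỹ^b z̃^c` of `f₀` has
`M·d ≤ a + M(b+c)`) with `2 ≤ d` and `1 ≤ M`, each formal partial `∂ᵢ f₀` lies in `(ỹ, z̃) + (x^(M−1))`: `∂` kills even monomials (characteristic 2),
odd monomials with `b + c ≥ 1` have all partials in `(ỹ, z̃)` or `x`-exponent `≥ M(d−1) ≥ M`, and the pure powers `x^a` have `a ≥ Md`, `∂ₓ x^a ∈ (x^(M−1))`.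
[folklore] -/
theorem pderiv_mem_of_free_support {M d : ℕ} (hd : 2 ≤ d) (hM : 1 ≤ M) (f₀ : MvPowerSeries (Fin 3) K)
    (hsupp : ∀ e : Fin 3 →₀ ℕ, (∃ i, Odd (e i)) → coeff e f₀ ≠ 0 → M * d ≤ e 0 + M * (e 1 + e 2)) (i : Fin 3) :
    MvPowerSeries.pderiv i f₀ ∈ Ideal.span {(X 1 : MvPowerSeries (Fin 3) K), X 2} ⊔ Ideal.span {X 0 ^ (M - 1)} := by
  classical
  apply mem_span_X_X_sup_span_X_pow
  intro e he1 he2 he0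
  change coeff e (MvPowerSeries.pderivLinearMap i f₀) = 0
  rw [MvPowerSeries.coeff_pderivLinearMap]
  -- the relevant monomial of f₀ is e' := e + single i 1
  set e' : Fin 3 →₀ ℕ := e + Finsupp.single i 1 with he'
  by_cases hpar : Even (e i + 1)
  · -- then the factor (e i + 1 : K) vanishes in characteristic 2
    obtain ⟨k, hk⟩ := hpar
    have : ((e i : K) + 1) = 0 := by
      have h2 : ((e i + 1 : ℕ) : K) = 0 := by
        rw [hk, ← two_mul, Nat.cast_mul, Nat.cast_ofNat, CharTwo.two_eq_zero, zero_mul]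
      simpa using h2
    rw [this, zero_mul]
  · -- e i + 1 odd ⇒ e' odd at i; if coeff e' f₀ ≠ 0 the support bound contradicts e 0 < M - 1
    rw [Nat.not_even_iff_odd] at hpar
    by_cases hz : coeff e' f₀ = 0
    · rw [hz, mul_zero]
    exfalso
    have hodd : ∃ j, Odd (e' j) := ⟨i, by simpa [he'] using hpar⟩
    have hb := hsupp e' hodd hz
    -- evaluate e' coordinates
    have e'0 : e' 0 = e 0 + (if i = 0 then 1 else 0) := by simp [he', Finsupp.single_apply]
    have e'1 : e' 1 = e 1 + (if i = 1 then 1 else 0) := by simp [he', Finsupp.single_apply]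
    have e'2 : e' 2 = e 2 + (if i = 2 then 1 else 0) := by simp [he', Finsupp.single_apply]
    rw [e'0, e'1, e'2, he1, he2] at hb
    have hMd : M * 2 ≤ M * d := Nat.mul_le_mul_left M hd
    fin_cases i <;> simp at hb <;> omega

/-- **F♭, ideal form.** `𝒥(f₀) := (∂ₓ f₀, ∂_ỹ f₀, ∂_z̃ f₀) ≤ (ỹ, z̃) + (x^(M−1))` after `M ≥ 1` free steps of exponent `d ≥ 2`. [folklore] -/
theorem jacobian_le_of_free_support {M d : ℕ} (hd : 2 ≤ d) (hM : 1 ≤ M) (f₀ : MvPowerSeries (Fin 3) K)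
    (hsupp : ∀ e : Fin 3 →₀ ℕ, (∃ i, Odd (e i)) → coeff e f₀ ≠ 0 → M * d ≤ e 0 + M * (e 1 + e 2)) :
    Ideal.span (Set.range fun i : Fin 3 => MvPowerSeries.pderiv i f₀) ≤
      Ideal.span {(X 1 : MvPowerSeries (Fin 3) K), X 2} ⊔ Ideal.span {X 0 ^ (M - 1)} := by
  rw [Ideal.span_le]
  rintro _ ⟨i, rfl⟩
  exact pderiv_mem_of_free_support hd hM f₀ hsupp i

end Summit.ResolutionOfSingularities.ResolutionOfSingularities.Theorems.SwitchingDichotomy.G3Perf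

end
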